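import Mathlib
import Summits.Ventures.HodgeRepro2.T5CyclotomicSubfieldHeckeCommutative
import Summits.Ventures.HodgeRepro2.T5IntegralGramBadSet

/-!
# THE EXCEPTIONAL SET OF THE RECORD'S HECKE COMMUTATIVITY IS CONTAINED IN THE SUPPORT OF THE RELATIVE
# DIFFERENT, FOR EVERY CM FIELD

Tier-5 support N3 / §G-N4.2 (seat p3, gen 82). File 234 / 236 (R9) proves the commutativity of the record's
spherical Hecke algebra `H(U(1 ⊗ H), K_v)` at every place `w ∣ v` with `e(w/v) = 1` and `w ∉ badSet H`, and that a
finite set of places of `K⁺` carries every exception — with no description of that set for a general CM field `K`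
(file 304 describes it for the CM subfields of `ℚ(ζₘ)`). Mathlib's different ideal gives the description for EVERY CM
field: a prime `w` of `K` is unramified over `K⁺` iff it does not divide the relative different
`𝔇_{K/K⁺} = differentIdeal 𝓞_{K⁺} 𝓞_K` (Mathlib's `not_dvd_differentIdeal_iff`), so

* `ramificationIdx'_eq_one_of_not_dvd_differentIdeal` — `e(w/v) = 1` for `w ∤ 𝔇`;
* **`recordCommutative_of_not_dvd_differentIdeal`** — `H(U(1 ⊗ H), K_v)` is commutative at every place `v` of `K⁺`
  with a place `w ∣ v` of `K` not dividing `𝔇` and good for `H`; **`recordPolynomial_of_not_dvd_differentIdeal`** —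
  `k[X]` when moreover `v` has one prime above it;
* **`finite_setOf_exists_dvd_differentIdeal`** — the places of `K⁺` under a prime divisor of `𝔇` form a FINITE set
  (`𝔇 ≠ 0`, `Ideal.finite_factors`);
* **`recordCommutative_of_notMem`** / **`subset_setOf_exists_dvd_differentIdeal`** — for an integral unimodular `H`
  (file 311), the set of places at which the algebra is NOT commutative is contained in that finite set: THE
  EXCEPTIONAL SET OF R9, EXPLICIT FOR EVERY CM FIELD.

§8(d): uses an L-value-free non-vanishing device: NO.
-/

open Matrix NumberField NumberField.IsCMField IsDedekindDomain IsDedekindDomain.HeightOneSpectrum Module Polynomial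
  Ideal
open scoped TensorProduct Pointwise
open Summit.Ventures.HodgeRepro2.T5UnitaryGroupForm Summit.Ventures.HodgeRepro2.T5UnitaryHeckeAdjoint
  Summit.Ventures.HodgeRepro2.T5HeckePermutationModule Summit.Ventures.HodgeRepro2.T5HeckeDoubleCoset
  Summit.Ventures.HodgeRepro2.T5RecordHyperspecial Summit.Ventures.HodgeRepro2.T5GlobalLatticeAlmostAll
  Summit.Ventures.HodgeRepro2.T5FinitePlaceSplitClassification Summit.Ventures.HodgeRepro2.T5RecordSatakeIntrinsic
  Summit.Ventures.HodgeRepro2.T5SplitPlaceUnitaryGroup Summit.Ventures.HodgeRepro2.T5NonSplitPlaceUnitaryGroup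
  Summit.Ventures.HodgeRepro2.T5FinitePlaceCM Summit.Ventures.HodgeRepro2.T5StarOfInvolution
  Summit.Ventures.HodgeRepro2.T5CyclotomicSubfieldHeckeCommutative
  Summit.Ventures.HodgeRepro2.T5IntegralGramBadSet

namespace Summit.Ventures.HodgeRepro2.T5RecordSatakeDifferent

section Different

variable (K : Type*) [Field K] [NumberField K] [IsCMField K]

omit [IsCMField K] in
/-- **A prime of `K` not dividing the relative different is unramified over `K⁺`**: `e(w/v) = 1` (Mathlib's
`not_dvd_differentIdeal_iff` and `ramificationIdx_eq_one`). -/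
theorem ramificationIdx'_eq_one_of_not_dvd_differentIdeal (w : HeightOneSpectrum (𝓞 K))
    (h : ¬ w.asIdeal ∣ differentIdeal (𝓞 (maximalRealSubfield K)) (𝓞 K)) :
    (w.asIdeal.under (𝓞 (maximalRealSubfield K))).ramificationIdx' w.asIdeal = 1 := by
  haveI : Algebra.IsUnramifiedAt (𝓞 (maximalRealSubfield K)) w.asIdeal := not_dvd_differentIdeal_iff.mp h
  have hp : w.asIdeal.under (𝓞 (maximalRealSubfield K)) ≠ ⊥ := by
    intro hbot
    exact w.ne_bot (Ideal.eq_bot_of_comap_eq_bot hbot)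
  rw [Ideal.ramificationIdx'_eq_ramificationIdx _ _ hp]
  exact Ideal.ramificationIdx_eq_one w.asIdeal (𝓞 (maximalRealSubfield K))

omit [IsCMField K] in
/-- The same for a place `w` over a given place `v` of `K⁺`: `v.ramificationIdx' w = 1`. -/
theorem ramificationIdx'_eq_one_of_liesOver_of_not_dvd_differentIdeal
    (v : HeightOneSpectrum (𝓞 (maximalRealSubfield K))) (w : HeightOneSpectrum (𝓞 K))
    [hw : w.asIdeal.LiesOver v.asIdeal]
    (h : ¬ w.asIdeal ∣ differentIdeal (𝓞 (maximalRealSubfield K)) (𝓞 K)) :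
    v.asIdeal.ramificationIdx' w.asIdeal = 1 := by
  rw [hw.over]
  exact ramificationIdx'_eq_one_of_not_dvd_differentIdeal K w h

variable (v : HeightOneSpectrum (𝓞 (maximalRealSubfield K)))
variable {r : ℕ} (l : Fin r → 𝓞 K) (k : Type*) [Field k]

/-- **COMMUTATIVE AT EVERY PLACE `v` OF `K⁺` WITH A PLACE `w ∣ v` NOT DIVIDING THE DIFFERENT AND GOOD FOR `H`**
(file 236's `heckeAlgebra_mul_comm_record_of_ramificationIdx'_eq_one`), for every CM field `K`. -/
theorem recordCommutative_of_not_dvd_differentIdeal (w : HeightOneSpectrum (𝓞 K))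
    [w.asIdeal.LiesOver v.asIdeal] (h : ¬ w.asIdeal ∣ differentIdeal (𝓞 (maximalRealSubfield K)) (𝓞 K))
    (hl : Submodule.span (𝓞 (maximalRealSubfield K)) (Set.range l) = ⊤)
    {H : Matrix (Fin 3) (Fin 3) K} (hH : H.IsHermitian) (hdet : IsUnit H.det) (hgood : w ∉ badSet H) :
    RecordCommutative K v l k H :=
  fun T S => heckeAlgebra_mul_comm_record_of_ramificationIdx'_eq_one K v w l k hl
    (ramificationIdx'_eq_one_of_liesOver_of_not_dvd_differentIdeal K v w h) hH hdet hgood T S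

/-- **`k[X]` at every such place with one prime above it** (file 236's
`nonempty_algEquiv_polynomial_record_of_ramificationIdx'_eq_one`). -/
theorem recordPolynomial_of_not_dvd_differentIdeal (w : HeightOneSpectrum (𝓞 K))
    [w.asIdeal.LiesOver v.asIdeal] (h : ¬ w.asIdeal ∣ differentIdeal (𝓞 (maximalRealSubfield K)) (𝓞 K))
    (h1 : (v.asIdeal.primesOver (𝓞 K)).ncard = 1)
    (hl : Submodule.span (𝓞 (maximalRealSubfield K)) (Set.range l) = ⊤)
    {H : Matrix (Fin 3) (Fin 3) K} (hH : H.IsHermitian) (hdet : IsUnit H.det) (hgood : w ∉ badSet H) :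
    RecordPolynomial K v l k H :=
  nonempty_algEquiv_polynomial_record_of_ramificationIdx'_eq_one K v w l k hl
    (ramificationIdx'_eq_one_of_liesOver_of_not_dvd_differentIdeal K v w h) h1 hH hdet hgood

end Different

section Finite

variable (K : Type*) [Field K] [NumberField K] [IsCMField K]

omit [IsCMField K] in
/-- **The places of `K⁺` under a prime divisor of the relative different form a finite set** (`𝔇 ≠ 0` and
Mathlib's `Ideal.finite_factors`). -/
theorem finite_setOf_exists_dvd_differentIdeal :
    {v : HeightOneSpectrum (𝓞 (maximalRealSubfield K)) | ∃ w : HeightOneSpectrum (𝓞 K),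
      w.asIdeal.LiesOver v.asIdeal ∧ w.asIdeal ∣ differentIdeal (𝓞 (maximalRealSubfield K)) (𝓞 K)}.Finite := by
  have hfin : {w : HeightOneSpectrum (𝓞 K) |
      w.asIdeal ∣ differentIdeal (𝓞 (maximalRealSubfield K)) (𝓞 K)}.Finite :=
    Ideal.finite_factors differentIdeal_ne_bot
  refine ((hfin.image fun w : HeightOneSpectrum (𝓞 K) => w.asIdeal.under (𝓞 (maximalRealSubfield K))).preimage
    (Function.Injective.injOn (f := fun v : HeightOneSpectrum (𝓞 (maximalRealSubfield K)) => v.asIdeal)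
      fun a b h => HeightOneSpectrum.ext h)).subset ?_
  rintro v ⟨w, hwv, hw⟩
  exact ⟨w, hw, hwv.over.symm⟩

variable (v : HeightOneSpectrum (𝓞 (maximalRealSubfield K)))
variable {r : ℕ} (l : Fin r → 𝓞 K) (k : Type*) [Field k]
  (hl : Submodule.span (𝓞 (maximalRealSubfield K)) (Set.range l) = ⊤)
variable (M : Matrix (Fin 3) (Fin 3) (𝓞 K)) (hM : IsUnit M.det)
  (hH : ((algebraMap (𝓞 K) K).mapMatrix M).IsHermitian)

include hl hM hH in
/-- **For an integral unimodular Gram matrix, commutative at every place of `K⁺` under no prime divisor of the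
different** (a place `w ∣ v` exists — Mathlib's `Ideal.nonempty_primesOver` — and is good for `H` by file 311). -/
theorem recordCommutative_of_notMem
    (hv : v ∉ {v : HeightOneSpectrum (𝓞 (maximalRealSubfield K)) | ∃ w : HeightOneSpectrum (𝓞 K),
      w.asIdeal.LiesOver v.asIdeal ∧ w.asIdeal ∣ differentIdeal (𝓞 (maximalRealSubfield K)) (𝓞 K)}) :
    RecordCommutative K v l k ((algebraMap (𝓞 K) K).mapMatrix M) := by
  obtain ⟨P, hP, hPv⟩ := (Ideal.nonempty_primesOver (S := 𝓞 K) v.asIdeal).some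
  haveI := hP
  haveI := hPv
  let w : HeightOneSpectrum (𝓞 K) := ⟨P, hP, Ideal.ne_bot_of_liesOver_of_ne_bot v.ne_bot P⟩
  haveI : w.asIdeal.LiesOver v.asIdeal := hPv
  have h : ¬ w.asIdeal ∣ differentIdeal (𝓞 (maximalRealSubfield K)) (𝓞 K) := fun hdvd => hv ⟨w, hPv, hdvd⟩
  exact recordCommutative_of_not_dvd_differentIdeal K v l k w h hl hH (isUnit_det_mapMatrix M hM)
    (notMem_badSet_mapMatrix M hM w)

include hl hM hH in
/-- **THE EXCEPTIONAL SET OF R9, EXPLICIT FOR EVERY CM FIELD**: for an integral unimodular hermitian `H`, the set of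
places `v` of `K⁺` at which `H(U(1 ⊗ H), K_v)` is not commutative is contained in the finite set of places under a
prime divisor of the relative different `𝔇_{K/K⁺}`. -/
theorem subset_setOf_exists_dvd_differentIdeal :
    {v : HeightOneSpectrum (𝓞 (maximalRealSubfield K)) |
        ¬ RecordCommutative K v l k ((algebraMap (𝓞 K) K).mapMatrix M)} ⊆
      {v : HeightOneSpectrum (𝓞 (maximalRealSubfield K)) | ∃ w : HeightOneSpectrum (𝓞 K),
        w.asIdeal.LiesOver v.asIdeal ∧ w.asIdeal ∣ differentIdeal (𝓞 (maximalRealSubfield K)) (𝓞 K)} := by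
  intro v hv
  by_contra hnot
  exact hv (recordCommutative_of_notMem K v l k hl M hM hH hnot)

include hl hM hH in
/-- The exceptional set is finite — with the explicit bound above. -/
theorem finite_setOf_not_recordCommutative :
    {v : HeightOneSpectrum (𝓞 (maximalRealSubfield K)) |
      ¬ RecordCommutative K v l k ((algebraMap (𝓞 K) K).mapMatrix M)}.Finite :=
  (finite_setOf_exists_dvd_differentIdeal K).subset (subset_setOf_exists_dvd_differentIdeal K l k hl M hM hH)

end Finite

end Summit.Ventures.HodgeRepro2.T5RecordSatakeDifferent
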